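import Mathlib.RepresentationTheory.Homological.GroupCohomology.Shapiro
import Mathlib.RepresentationTheory.Homological.GroupCohomology.LongExactSequence
import Mathlib.RepresentationTheory.Homological.GroupCohomology.LowDegree
import Mathlib.GroupTheory.QuotientGroup.Finite
import Mathlib.GroupTheory.Index
import HarnessLib

/-!
# Finite group cohomology: finite-type resolutions and finite-index ascent

Topic `Algebra/Homology`; namespace `Literature.Algebra.Homology`.  Theorems only (Mathlib-only
imports; no definition, no named fact, no instance, no `sorry`).

Three elementary finiteness statements about Mathlib's group cohomology
`groupCohomology A n = Hⁿ(G, A)` of a `k`-linear representation `A : Rep k G` whose underlying set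
is FINITE — the "finite coefficients" bookkeeping in the passage from the Borel–Serre theorem
"arithmetic groups are of type (WFL)" ([BorelSerre1973, Thm. 11.4.4]) to the finiteness of
`H^q(Γ, M)` for `Γ` arithmetic and `M` finite ([Serre1971CohomologieGroupesDiscrets, §1.8
Remarque]; [Brown1982CohomologyGroups, VIII (5.1), VIII.4 Exercise 1]):

* `finite_groupCohomology_of_finiteType_resolution` — if the trivial representation `k` has a
  projective resolution `P` with every `P_i ≅ k[G]^{m_i}` free of finite rank (`G` of type `FP_∞`
  with free modules, e.g. of type (FL)), then `Hⁿ(G, A)` is finite for `A` finite: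
  `Hom(k[G]^m, A) ≅ A^m` is finite (the `Finite` analogue of
  `moduleFinite_groupCohomology_of_finiteType_resolution` in `GroupCohomologyFiniteTypeResolution`);
* `finite_coind_of_finiteIndex` — for `S ≤ G` of finite index and `B : Rep k S` finite, the
  coinduced representation `Coind_S^G B` (Mathlib `Rep.coind S.subtype B`: `S`-equivariant functions
  `G → B`) is finite (a function is determined by its values on right-coset representatives);
* `finite_groupCohomology_of_finiteIndex` — **finite-index ascent**: if `S ≤ G` has finite index
  and `Hⁿ(S, B)` is finite for every finite `B : Rep k S` and every `n`, then `Hⁿ(G, A)` is finite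
  for every finite `A : Rep k G` and every `n`.  Proof by dimension shifting: the unit
  `A ↪ Coind_S^G Res_S A`, `a ↦ (g ↦ ρ(g) a)`, is injective with finite cokernel `Q`; in the long
  exact sequence `Hⁿ(G, Q) → Hⁿ⁺¹(G, A) → Hⁿ⁺¹(G, Coind Res A) ≅ Hⁿ⁺¹(S, Res A)` (Mathlib
  `groupCohomology.mapShortComplex₁_exact`, Shapiro `groupCohomology.coindIso`) the outer terms are
  finite by induction on `n` and by hypothesis; `H⁰(G, A) = Aᴳ ⊆ A` starts the induction;
* `finite_groupCohomology_subgroup_of_finiteIndex` (descent, Shapiro),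
  `finite_groupCohomology_iff_of_finiteIndex`, `finite_groupCohomology_of_mulEquiv` (transport
  along `G ≃* H`, Mathlib `groupCohomology.mapIso`) and `finite_groupCohomology_of_commensurable`
  — "`Hⁿ(-, M)` finite for all finite `M` and all `n`" is an invariant of the commensurability
  class ([Brown1982CohomologyGroups, VIII (5.1)] for type `FP_n`; here its consequence for finite
  coefficients).

Not here: the `Module.Finite` / `FiniteDimensional` versions of the ascent (same proof), and
anything about arithmetic groups (see
`NumberTheory/Automorphic/ArithmeticQuotientCohomologyFiniteProofs`).

## References

* K. S. Brown, *Cohomology of Groups*, GTM 87 (1982), III (5.9), (6.2) Shapiro's lemma, VIII (5.1),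
  VIII.4 Exercise 1 [Brown1982CohomologyGroups].
* J.-P. Serre, *Cohomologie des groupes discrets*, Ann. of Math. Studies 70 (1971), §1.8
  [Serre1971CohomologieGroupesDiscrets].
-/

noncomputable section

namespace Literature.Algebra.Homology

open CategoryTheory

universe u

variable {k G : Type u} [CommRing k] [Group G]

/-! ### Finite-type free resolutions give finite cohomology with finite coefficients -/

/-- `Hom_{Rep}(X, A)` is finite when `X ≅ k[G]^m` is free of finite rank and `A` is finite
(`Hom(k[G]^m, A) ≅ A^m`, Mathlib `Rep.freeLiftLEquiv`, `Linear.homCongr`). [folklore] -/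
theorem finite_hom_of_iso_free (X A : Rep k G) [Finite A] {m : ℕ}
    (e : X ≅ Rep.free k G (Fin m)) : Finite (X ⟶ A) := by
  have e1 : (X ⟶ A) ≃ₗ[k] (Rep.free k G (Fin m) ⟶ A) := Linear.homCongr k e (Iso.refl A)
  have e2 : (Rep.free k G (Fin m) ⟶ A) ≃ₗ[k] (Fin m → A) := Rep.freeLiftLEquiv k G (Fin m) A
  exact Finite.of_equiv _ (e1.trans e2).toEquiv.symm

/-- The `n`-th homology of a complex of `k`-modules whose `n`-th term is finite is finite: a
quotient of the cycles, a submodule of the `n`-th term (Mathlib `HomologicalComplex.homologyπ`,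
`iCycles`). [folklore] -/
theorem finite_homology_of_finite_X {ι : Type*} {c : ComplexShape ι}
    (C : HomologicalComplex (ModuleCat.{u} k) c) (n : ι) [Finite (C.X n)] :
    Finite (C.homology n) := by
  haveI : Finite (C.cycles n) :=
    Finite.of_injective (C.iCycles n).hom
      ((ModuleCat.mono_iff_injective (C.iCycles n)).1 inferInstance)
  exact Finite.of_surjective (C.homologyπ n).hom
    ((ModuleCat.epi_iff_surjective (C.homologyπ n)).1 inferInstance)

/-- **Finite group cohomology from a free resolution of finite type.**  If the trivial
representation `k` of `G` has a projective resolution `P` in `Rep k G` with every term isomorphic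
to a free `k[G]`-module of finite rank (e.g. `G` of type (FL)), then `Hⁿ(G, A) = groupCohomology A n`
is finite for every representation `A` with finitely many elements and every `n`: Mathlib's
`groupCohomologyIso A n P : groupCohomology A n ≅ Hⁿ(Hom(P_•, A))` and `Hom(P_n, A) ≅ A^{m_n}` is
finite (Brown VIII.4 Exercise 1, with "finite" for "finitely generated").
[cite: Brown1982CohomologyGroups, VIII.4 Exercise 1 and VIII (4.5)] -/
theorem finite_groupCohomology_of_finiteType_resolution
    (P : ProjectiveResolution (Rep.trivial k G k))
    (hP : ∀ i, ∃ m : ℕ, Nonempty (P.complex.X i ≅ Rep.free k G (Fin m)))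
    (A : Rep k G) [Finite A] (n : ℕ) : Finite (groupCohomology A n) := by
  obtain ⟨m, ⟨e⟩⟩ := hP n
  haveI : Finite ((P.complex.linearYonedaObj k A).X n) := by
    rw [ChainComplex.linearYonedaObj_X]
    exact finite_hom_of_iso_free _ A e
  haveI := finite_homology_of_finite_X (P.complex.linearYonedaObj k A) n
  exact Finite.of_equiv _ (groupCohomologyIso A n P).toLinearEquiv.toEquiv.symm

/-! ### Coinduction along a subgroup of finite index preserves finiteness -/

/-- For a subgroup `S ≤ G` of finite index and a finite `S`-representation `B`, the coinduced
representation `Coind_S^G B` (the `S`-equivariant functions `f : G → B`, `f (s g) = s • f g`) is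
finite: `f` is determined by its values on a (finite) set of right-coset representatives.
[folklore] -/
theorem finite_coind_of_finiteIndex (S : Subgroup G) [S.FiniteIndex] (B : Rep k S) [Finite B] :
    Finite (Rep.coind S.subtype B) := by
  haveI : Finite (Quotient (QuotientGroup.rightRel S)) :=
    Finite.of_equiv _ (QuotientGroup.quotientRightRelEquivQuotientLeftRel S).symm
  refine Finite.of_injective
    (fun (f : Rep.coind S.subtype B) (q : Quotient (QuotientGroup.rightRel S)) => f.1 q.out) ?_
  intro f₁ f₂ h
  apply Subtype.ext
  funext g
  set q : Quotient (QuotientGroup.rightRel S) := Quotient.mk _ g with hq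
  have hmem : g * q.out⁻¹ ∈ S := by
    have h' := Quotient.mk_out (s := QuotientGroup.rightRel S) g
    rw [QuotientGroup.rightRel_apply] at h'
    exact h'
  have hg : g = S.subtype ⟨g * q.out⁻¹, hmem⟩ * q.out := by simp
  have hq' : f₁.1 q.out = f₂.1 q.out := congr_fun h q
  rw [hg, (Representation.mem_coindV _ _ _).1 f₁.2, (Representation.mem_coindV _ _ _).1 f₂.2, hq']

/-! ### Finite-index ascent by dimension shifting -/

/-- In an exact sequence `M₁ → M₂ → M₃` of `k`-modules with `M₁` and `M₃` finite, `M₂` is finite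
(`ker ≤ range`, Mathlib `AddGroup.fintypeOfKerLeRange`). [folklore] -/
theorem finite_of_exact {X : ShortComplex (ModuleCat.{u} k)} (hX : X.Exact)
    (h₁ : Finite X.X₁) (h₃ : Finite X.X₃) : Finite X.X₂ := by
  haveI := Fintype.ofFinite X.X₁
  haveI := Fintype.ofFinite X.X₃
  have hle : X.g.hom.toAddMonoidHom.ker ≤ X.f.hom.toAddMonoidHom.range := by
    intro x hx
    obtain ⟨y, hy⟩ := (X.moduleCat_exact_iff).1 hX x hx
    exact ⟨y, hy⟩
  haveI := AddGroup.fintypeOfKerLeRange _ _ hle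
  infer_instance

/-- One step of dimension shifting: for a short exact sequence `0 → X₁ → X₂ → X₃ → 0` of
representations, if `Hⁿ(G, X₃)` and `Hⁿ⁺¹(G, X₂)` are finite then so is `Hⁿ⁺¹(G, X₁)` (exactness of
`Hⁿ(G, X₃) → Hⁿ⁺¹(G, X₁) → Hⁿ⁺¹(G, X₂)`, Mathlib `groupCohomology.mapShortComplex₁_exact`).
[cite: Brown1982CohomologyGroups, III (5.9) and (6.2)] -/
theorem finite_groupCohomology_succ_of_shortExact {X : ShortComplex (Rep k G)}
    (hX : X.ShortExact) (n : ℕ) (h₃ : Finite (groupCohomology X.X₃ n))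
    (h₂ : Finite (groupCohomology X.X₂ (n + 1))) : Finite (groupCohomology X.X₁ (n + 1)) :=
  finite_of_exact (groupCohomology.mapShortComplex₁_exact hX (rfl : n + 1 = n + 1)) h₃ h₂

/-- `H⁰(G, A) = Aᴳ` is finite for `A` finite (Mathlib `groupCohomology.H0Iso`). [folklore] -/
theorem finite_groupCohomology_zero (A : Rep k G) [Finite A] : Finite (groupCohomology A 0) :=
  Finite.of_equiv _ (groupCohomology.H0Iso A).toLinearEquiv.toEquiv.symm

/-- **Finite-index ascent.**  Let `S ≤ G` be a subgroup of finite index such that `Hⁿ(S, B)` is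
finite for every `S`-representation `B` with finitely many elements and every `n`.  Then
`Hⁿ(G, A)` is finite for every `G`-representation `A` with finitely many elements and every `n`.
Dimension shifting along `0 → A → Coind_S^G Res_S A → Q → 0` (the unit `a ↦ (g ↦ ρ(g) a)` is
injective; the middle term, hence `Q`, is finite by `finite_coind_of_finiteIndex`), Shapiro's
lemma `Hⁿ⁺¹(G, Coind Res A) ≅ Hⁿ⁺¹(S, Res A)` (Mathlib `groupCohomology.coindIso`) and induction on
`n` over all finite `A` simultaneously. (Brown VIII (5.1) proves the corresponding statement for
type `FP_n`; Serre §1.8 for (FL)/(VFL); here only the cohomological consequence for finite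
coefficients is formalised.) [cite: Brown1982CohomologyGroups, III (6.2) Shapiro's lemma; VIII (5.1)]
[cite: Serre1971CohomologieGroupesDiscrets, §1.8] -/
theorem finite_groupCohomology_of_finiteIndex (S : Subgroup G) [S.FiniteIndex]
    (hS : ∀ (B : Rep k S), Finite B → ∀ n, Finite (groupCohomology B n))
    (n : ℕ) : ∀ (A : Rep k G), Finite A → Finite (groupCohomology A n) := by
  induction n with
  | zero => intro A hA; exact finite_groupCohomology_zero A
  | succ n ih =>
    intro A hA
    -- the unit `A ⟶ Coind_S^G Res_S A`
    let B : Rep k G := Rep.coind S.subtype (Rep.res S.subtype A)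
    let f : A ⟶ B := Rep.resCoindToHom S.subtype A (Rep.res S.subtype A) (𝟙 _)
    have hf : ∀ (a : A) (g : G), (f.hom a).1 g = A.ρ g a := fun a g => rfl
    have hfinj : Function.Injective f.hom := by
      intro a b h
      have h1 := congr_arg (fun x : B => x.1 1) h
      simpa only [hf, map_one, Module.End.one_apply] using h1
    -- its (G-stable) range and the quotient
    let W : Submodule k B := LinearMap.range f.hom.toLinearMap
    have hW : ∀ g, W ≤ W.comap (B.ρ g) := by
      rintro g _ ⟨a, rfl⟩
      exact ⟨A.ρ g a, Rep.hom_comm_apply f g a⟩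
    let X : ShortComplex (Rep k G) :=
      { X₁ := A
        X₂ := B
        X₃ := Rep.quotient B W hW
        f := f
        g := Rep.mkQ B W hW
        zero := by
          ext a
          exact (Submodule.Quotient.mk_eq_zero W).2 ⟨a, rfl⟩ }
    have hX : X.ShortExact :=
      { exact := (forget₂ (Rep k G) (ModuleCat k)).reflects_exact_of_faithful _ <|
          (ShortComplex.moduleCat_exact_iff _).2 fun x hx => by
            obtain ⟨a, ha⟩ := (Submodule.Quotient.mk_eq_zero W).1 hx
            exact ⟨a, ha⟩
        mono_f := (Rep.mono_iff_injective _).2 hfinj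
        epi_g := (Rep.epi_iff_surjective _).2 (Submodule.mkQ_surjective _) }
    -- finiteness of the terms
    haveI : Finite (Rep.res S.subtype A) := hA
    haveI hB : Finite B := finite_coind_of_finiteIndex S (Rep.res S.subtype A)
    haveI hQ : Finite (Rep.quotient B W hW) :=
      Finite.of_surjective (Submodule.mkQ W) (Submodule.mkQ_surjective W)
    have h₃ : Finite (groupCohomology X.X₃ n) := ih _ hQ
    have h₂ : Finite (groupCohomology X.X₂ (n + 1)) := by
      haveI := hS (Rep.res S.subtype A) hA (n + 1)
      exact Finite.of_equiv _
        (groupCohomology.coindIso (Rep.res S.subtype A) (n + 1)).toLinearEquiv.toEquiv.symm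
    exact finite_groupCohomology_succ_of_shortExact hX n h₃ h₂

/-! ### Finite-index descent and transport along group isomorphisms -/

/-- **Finite-index descent** (Shapiro): if `Hⁿ(G, A)` is finite for every finite `A : Rep k G`
and every `n`, then `Hⁿ(S, B) ≅ Hⁿ(G, Coind_S^G B)` is finite for every finite `B : Rep k S`,
`S ≤ G` of finite index (`finite_coind_of_finiteIndex`, Mathlib `groupCohomology.coindIso`).
[cite: Brown1982CohomologyGroups, III (6.2) Shapiro's lemma] -/
theorem finite_groupCohomology_subgroup_of_finiteIndex (S : Subgroup G) [S.FiniteIndex]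
    (hG : ∀ (A : Rep k G), Finite A → ∀ n, Finite (groupCohomology A n))
    (B : Rep k S) [Finite B] (n : ℕ) : Finite (groupCohomology B n) := by
  haveI := hG (Rep.coind S.subtype B) (finite_coind_of_finiteIndex S B) n
  exact Finite.of_equiv _ (groupCohomology.coindIso B n).toLinearEquiv.toEquiv

/-- For `S ≤ G` of finite index, "`Hⁿ(-, M)` is finite for all finite coefficients `M` and all
`n`" holds for `G` iff it holds for `S` (ascent `finite_groupCohomology_of_finiteIndex` and
descent `finite_groupCohomology_subgroup_of_finiteIndex`): the cohomological finiteness property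
is a commensurability invariant. [cite: Brown1982CohomologyGroups, VIII (5.1)]
[cite: Serre1971CohomologieGroupesDiscrets, §1.8] -/
theorem finite_groupCohomology_iff_of_finiteIndex (S : Subgroup G) [S.FiniteIndex] :
    (∀ (A : Rep k G), Finite A → ∀ n, Finite (groupCohomology A n)) ↔
      ∀ (B : Rep k S), Finite B → ∀ n, Finite (groupCohomology B n) :=
  ⟨fun hG B _ n => finite_groupCohomology_subgroup_of_finiteIndex S hG B n,
    fun hS A hA n => finite_groupCohomology_of_finiteIndex S hS n A hA⟩

/-- Transport along a group isomorphism `e : G ≃* H`: if `Hⁿ(G, B)` is finite for every finite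
`B : Rep k G` and every `n`, then `Hⁿ(H, A)` is finite for every finite `A : Rep k H` and every `n`
(`Hⁿ(G, Res_e A) ≅ Hⁿ(H, A)`, Mathlib `groupCohomology.mapIso`). [folklore] -/
theorem finite_groupCohomology_of_mulEquiv {H : Type u} [Group H] (e : G ≃* H)
    (hG : ∀ (B : Rep k G), Finite B → ∀ n, Finite (groupCohomology B n))
    (A : Rep k H) [Finite A] (n : ℕ) : Finite (groupCohomology A n) := by
  haveI := hG (Rep.res (e : G →* H) A) ‹Finite A› n
  exact Finite.of_equiv _ (groupCohomology.mapIso (A := A) (B := Rep.res (e : G →* H) A) e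
    (LinearEquiv.refl k _) (fun _ => rfl) n).toLinearEquiv.toEquiv

/-- **Commensurable subgroups.**  If `Γ₀, Γ ≤ G` are commensurable (`Γ ∩ Γ₀` of finite index in
both) and `Hⁿ(Γ₀, B)` is finite for every finite `B : Rep k Γ₀` and every `n`, then `Hⁿ(Γ, A)` is
finite for every finite `A : Rep k Γ` and every `n`: descend from `Γ₀` to `Γ ∩ Γ₀`
(`finite_groupCohomology_subgroup_of_finiteIndex`), transport along
`(Γ ∩ Γ₀ ≤ Γ₀) ≃* (Γ ∩ Γ₀ ≤ Γ)` (`finite_groupCohomology_of_mulEquiv`), ascend to `Γ`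
(`finite_groupCohomology_of_finiteIndex`). [cite: Serre1971CohomologieGroupesDiscrets, §1.8]
[cite: Brown1982CohomologyGroups, VIII (5.1)] -/
theorem finite_groupCohomology_of_commensurable (Γ₀ Γ : Subgroup G)
    [(Γ.subgroupOf Γ₀).FiniteIndex] [(Γ₀.subgroupOf Γ).FiniteIndex]
    (h₀ : ∀ (B : Rep k Γ₀), Finite B → ∀ n, Finite (groupCohomology B n))
    (A : Rep k Γ) [Finite A] (n : ℕ) : Finite (groupCohomology A n) := by
  haveI : ((Γ ⊓ Γ₀).subgroupOf Γ₀).FiniteIndex := by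
    rw [Subgroup.inf_subgroupOf_right]
    infer_instance
  haveI : ((Γ ⊓ Γ₀).subgroupOf Γ).FiniteIndex := by
    rw [Subgroup.inf_subgroupOf_left]
    infer_instance
  have h₁ : ∀ (B : Rep k ((Γ ⊓ Γ₀).subgroupOf Γ₀)), Finite B → ∀ m,
      Finite (groupCohomology B m) :=
    fun B hB m => by
      haveI := hB
      exact finite_groupCohomology_subgroup_of_finiteIndex _ h₀ B m
  have e : (Γ ⊓ Γ₀).subgroupOf Γ₀ ≃* (Γ ⊓ Γ₀).subgroupOf Γ :=
    (Subgroup.subgroupOfEquivOfLe inf_le_right).trans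
      (Subgroup.subgroupOfEquivOfLe inf_le_left).symm
  have h₂ : ∀ (B : Rep k ((Γ ⊓ Γ₀).subgroupOf Γ)), Finite B → ∀ m,
      Finite (groupCohomology B m) :=
    fun B hB m => by
      haveI := hB
      exact finite_groupCohomology_of_mulEquiv e h₁ B m
  exact finite_groupCohomology_of_finiteIndex _ h₂ n A ‹Finite A›

end Literature.Algebra.Homology
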